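import Summits.HodgeConjecture.HodgeConjecture.Theorems.VHCAbelianSchemesRoadServedFibreDefs
import HarnessLib

/-!
# Road b02 (`VHCAbelianSchemesRoad`) — EXCEPTIONAL CELL-SHAPED PENCILS THROUGH A POLARISED VARIETY (definition only)

research route conditional on HC_CM; not a corollary; Q11.4-sentence-2 already refuted in dim ≥ 3.

DEFINITION ONLY (nothing asserted, nothing proved, `HC_CM` absent). The served-fibre partition of a cell `(n, p)` of K-SR♭∃
(`VHCAbelianSchemesRoadServedFibreDefs`, PART AA) is NON-VACUOUS at pencil level as soon as ONE anchor `(X, θ)` with a served class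
`w` sits on a pencil OF THE CELL'S SHAPE on which (the continuation of) `w` is somewhere exceptional. PART AA's anchors file
(`VHCAbelianSchemesRoadServedFibreAnchors`) realises this with the CONSTANT pencil `X × 𝔸¹`, which is inside the cell's regime 2 only
when `w ∉ Dᵖ(X) ⊗ ℂ` AT the anchor. At Markman's secant-quotient anchors `Y_d = (X × X̂)/Ḡ`, `X = Pic²(C)` with `C` a GENERIC
genus-3 curve (arXiv:2502.03415 Thm. 1.4.1), that hypothesis FAILS: the Mumford–Tate group of `X` is `GSp₆`, so by the first
fundamental theorem for `Sp` every Hodge class of `X × X̂` — isogeny-invariantly, of `Y_d` — is a polynomial in divisor classes, and the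
served Weil class `γ_Y` lies IN `D³(Y_d) ⊗ ℂ` (ring2 LEAD gen 151 finding F2; ring2-b03 gen 76). The pencil that witnesses non-vacuity
there is a genuine split-Weil sixfold pencil THROUGH the anchor fibre, exceptional at its general member (van Geemen 1994 Thm. 4.11).

This file types, anchor-generically, the set of classes so continued:

* `exceptionalPencilClassesThrough n p X θ : Set H^{2p}(X(ℂ); ℂ)` — the classes `w` on `X` for which there are a one-parameter
  family `f : 𝒳 ⟶ S` satisfying EVERY binder of the cell `LefAtExceptionalRegimeAt _ n p` (smooth projective of relative dimension `n`,
  quasi-projective total space, smooth irreducible affine base of Krull dimension one, fibres isomorphic to abelian `n`-folds, a section),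
  a complex point `sₐ` with an isomorphism `e : X ≅ 𝒳_{sₐ}`, a GLOBAL class `Θ ∈ H²(𝒳(ℂ); ℂ)` with rational `(1,1)` restrictions on
  every fibre and `Θ|_{sₐ} = (e⁻¹)^*θ`, and a GLOBAL class `W ∈ H^{2p}(𝒳(ℂ); ℂ)` with rational `(p,p)` restrictions on every fibre,
  `W|_{sₐ} = (e⁻¹)^*w`, which is NOT algebraic-Lefschetz on every fibre (`¬ ∀ s, W|ₛ ∈ algebraicClasses ∧ W|ₛ ∈ Dᵖ ⊗ ℂ`).

Data (a `Set`), not a statement. With it the companion proof file `VHCAbelianSchemesRoadPencilThrough` proves, fact-free: an anchor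
`(X, θ)` (anchor data transportable along isomorphisms) with a served ALGEBRAIC class `w ∈ exceptionalPencilClassesThrough n p X θ`
yields a pencil of the cell's shape IN REGIME 2 with a served fibre — the tribunal's pencil-level «no cosmetic split» witness —, and
`w ∉ Dᵖ(X) ⊗ ℂ` (with `X ≅` an abelian `n`-fold, `θ`, `w` rational of types `(1,1)`, `(p,p)`) implies membership via the constant pencil,
so PART AA's criterion is the special case. Which anchors carry such pencils is NOT said here: for the `(6, 3)` Markman instance it is
the existence of a cell-shaped split-Weil pencil through `(Y_d, h_Y)` carrying the flat continuation of `γ_Y` — van Geemen's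
connected `9`-dimensional family (Lemma 5.2, 5.3–5.5) cut to a curve —, a named hypothesis of the instance file
(`VHCAbelianSchemesRoadSecantAnchorInhabited`), not a theorem of the tree.
References: [cite: vanGeemen1994HodgeAV, §2.4, Thm. 4.11 and 5.3–5.5] [cite: Markman2025SecantWeil, Thm. 1.4.1 and Thm. 1.5.1]
[cite: Bloch1972Semiregularity, Remark (7.5)] [cite: VoisinHodgeI2002, §7.1.2 and Thm. 11.30].
-/

noncomputable section

open CategoryTheory CategoryTheory.Limits AlgebraicGeometry Topology

namespace Summit.HodgeConjecture.HodgeConjecture.Ring2.SemiregularRepresentatives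

-- the cell's namespace repeats the summit name (`Summit.HodgeConjecture.HodgeConjecture…`), as in every `Ring2*` file
set_option linter.dupNamespace false

open Literature.AlgebraicGeometry Literature.AlgebraicGeometry.Motives
open Literature.AlgebraicGeometry.HodgeTheory
open Literature.AlgebraicTopology.SingularHomology
open Literature.Barriers.HodgeConjecture (divisorClassesSpan)

/-- **The classes on `X` continued by a SOMEWHERE-EXCEPTIONAL global class along a CELL-SHAPED pencil through `(X, θ)`**
(`exceptionalPencilClassesThrough n p X θ`): `w` belongs to it iff there are a family `f : 𝒳 ⟶ S` satisfying every binder of the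
cell `(n, p)` of K-SR♭∃ (smooth projective of relative dimension `n`, `𝒳` quasi-projective, `S` affine smooth irreducible of Krull
dimension `1`, every fibre isomorphic to an abelian `n`-fold, a section), a complex point `sₐ` and an isomorphism `e : X ≅ 𝒳_{sₐ}`,
a global class `Θ` with rational `(1,1)` restrictions on every fibre and `Θ|_{sₐ} = (e⁻¹)^*θ`, and a global class `W` with rational
`(p,p)` restrictions on every fibre and `W|_{sₐ} = (e⁻¹)^*w` that is not algebraic-Lefschetz on every fibre. In print, for a
polarised abelian variety of Weil type `(X, K, θ)` and a Weil class `w`: the universal family over a curve in (a level cover of) the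
connected component of Weil's moduli space through `(X, K, θ)`, `Θ` the relative polarisation, `W` the flat Weil section (global
invariant cycle theorem), exceptional at the general member. [cite: vanGeemen1994HodgeAV, Thm. 4.11 and 5.3–5.5]
[cite: VoisinHodgeI2002, §7.1.2] [cite: Bloch1972Semiregularity, Remark (7.5)] -/
def exceptionalPencilClassesThrough (n p : ℕ) (X : SchemeOver ℂ) (θ : complexBetti X 2) : Set (complexBetti X (2 * p)) :=
  {w | ∃ (𝒳 S : SchemeOver ℂ) (f : 𝒳 ⟶ S) (sₐ : ComplexPoints S) (e : X ≅ fiberOver f sₐ)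
      (Θ : complexBetti 𝒳 2) (W : complexBetti 𝒳 (2 * p)),
      IsSmoothProjectiveFamily f n ∧ IsQuasiProjectiveOver 𝒳 ∧ IrreducibleSpace S.left ∧ IsAffine S.left ∧
      AlgebraicGeometry.Smooth S.hom ∧ topologicalKrullDim S.left = 1 ∧
      (∀ s : ComplexPoints S, ∃ A' : AbelianVariety ℂ, A'.dim = n ∧ Nonempty (A'.X ≅ fiberOver f s)) ∧
      (∃ e₀ : S ⟶ 𝒳, e₀ ≫ f = 𝟙 S) ∧
      (∀ s : ComplexPoints S, IsRationalClass (complexBetti.map (fiberι f s) 2 Θ)) ∧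
      (∀ s : ComplexPoints S, IsOfHodgeType n (fiberOver f s) 2 1 1 (complexBetti.map (fiberι f s) 2 Θ)) ∧
      (∀ s : ComplexPoints S, IsRationalClass (complexBetti.map (fiberι f s) (2 * p) W) ∧
        IsOfHodgeType n (fiberOver f s) (2 * p) p p (complexBetti.map (fiberι f s) (2 * p) W)) ∧
      complexBetti.map (fiberι f sₐ) 2 Θ = complexBetti.map e.inv 2 θ ∧
      complexBetti.map (fiberι f sₐ) (2 * p) W = complexBetti.map e.inv (2 * p) w ∧
      ¬ ∀ s : ComplexPoints S,
        complexBetti.map (fiberι f s) (2 * p) W ∈ algebraicClasses (fiberOver f s) p ∧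
        complexBetti.map (fiberι f s) (2 * p) W ∈ divisorClassesSpan (fiberOver f s) n p}

end Summit.HodgeConjecture.HodgeConjecture.Ring2.SemiregularRepresentatives

end
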